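import Summits.BirchSwinnertonDyer.BirchSwinnertonDyer.Theorems.BiquadraticEisensteinDescentHeegnerTwistCouplingInSupplyCornersThreeFacts
import Summits.BirchSwinnertonDyer.BirchSwinnertonDyer.Theorems.BiquadraticEisensteinDescentHeegnerTwistCouplingInSupplyRoundingPinCruxOnFamily
import Literature.NumberTheory.EllipticCurves.HeathBrown1994.CongruentTwoSelmerMonskyDoorsDeuringFree
import Literature.NumberTheory.EllipticCurves.CongruentNumberMonskySelmerRankZero
import Literature.NumberTheory.EllipticCurves.CongruentNumberEvenMonskySelmerExact
import Literature.NumberTheory.EllipticCurves.CongruentNumberOddMonskySelmerExact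
import HarnessLib

set_option linter.dupNamespace false -- `Summit.BirchSwinnertonDyer.BirchSwinnertonDyer.Theorems.…` (summit = sub)
set_option autoImplicit false

/-!
# Crux `HeegnerTwistCouplingInSupply` (stmt-BirchSwinnertonDyer-21381) — ★★ the congruent corner `W = E_{2p}` (EVERY prime
# `p ≡ 3 (mod 4)`, `p ≥ 7`) modulo Burungale–Tian ONLY: Monsky's matrix theorem and Burungale–Flach removed

Route `BiquadraticEisensteinDescent` (cell `pub/bsd-wall`, width seat `bsd-wall-cm-bed-w3` g15; `--supports` 21381, helper).

The corner layer of this crux (leads `bsd-line-ibd-p1` g10/g11, width w2 g13 / w3 g12 / w4 g12) states the crux's CONCLUSION on the CM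
family `j = 1728` modulo named facts. After `…CornersThreeFacts` (Modularity removed), `…CornersEpOneFact` (the `E_p` corner by plain
`2`-isogeny descent) and `…RoundingPinCruxOnFamily` (the `E_p` corner for EVERY prime `p ≡ 7 (mod 8)`), exactly ONE ★ result still
displays more than Burungale–Tian's rank-zero `2`-converse: the corner `W = E_{2p}` (`cruxOnE2pCorner_of_three_facts`, and the crux body
on `{E_{2n}}`, `…RoundingPinCruxOnFamily.heegnerTwistCouplingInSupply_of_eq_congruentNumberCurve_two_mul`), modulo Monsky's `2`-descent
matrix theorem (even case) + Burungale–Tian + Burungale–Flach — because its cell `n = 2·p·q·5` is not sharp for plain `2`-isogeny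
descent (`#S⁽φ⁾ = 16`, kit j315629).

Binder audit (this seat): **Monsky's theorem is a THEOREM of the tree** — cell `bsd-monsky`, complete `2`-descent on the cohomological
Selmer group: `HeathBrown1994.monsky_card_selmerGroup_two_even_holds` (`CongruentNumberEvenMonskySelmerExact.lean`) and `…_odd_holds`
(`CongruentNumberOddMonskySelmerExact.lean`), landed 2026-08-27, before this layer was written; moreover the UPPER-BOUND half alone gives
`det M = 1 ⟹ #Sel₂(E_n/ℚ) = 4` with NO binder (`CongruentNumberMonskySelmer.card_selmerGroup_two_eq_four_of_det_even'/_odd'`,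
`CongruentNumberMonskySelmerRankZero.lean`), and `#Sel₂(E_n) = 4 ⟹ r_an(E_n) = 0 ∧ L(E_n, 1) ≠ 0` is the tree's door
`L_one_ne_zero_congruentNumberCurve_of_card_selmerGroup_two` modulo Burungale–Tian ONLY (continuation of `L(E_n, s)` =
`hasEntireLFunction_congruentNumberCurve_holds`). Burungale–Flach was used only to state the BSD triple alongside; the crux conclusion
needs `L ≠ 0` only. Hence:

* §1 `analyticRank_eq_zero_of_det_even_BT` / `…_odd_BT` — the journal doors of `…CornersE2pFourFacts` §1 with `hM` AND `hBF` deleted: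
  distinct odd primes `a, b, c` with `det M(a, b, c) = 1` ⟹ `r_an(E_{2abc}) = 0 ∧ L(E_{2abc}, 1) ≠ 0` (resp. `E_{abc}`), modulo
  Burungale–Tian ONLY; and, for consumers that want the BSD triple, `bsdTriple_of_det_even_BT_BF` / `…_odd_BT_BF` (Monsky fed by name);
* §2 ★★ `cruxOnE2pCorner_of_BT` — the statement of `…CornersThreeFacts.cruxOnE2pCorner_of_three_facts` VERBATIM with the hypotheses
  `hM` (Monsky) and `hBF` (Burungale–Flach) deleted: **for EVERY prime `p ≡ 3 (mod 4)`, `p ≥ 7`, a Heegner field `K′` of `N(E_{2p})`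
  with `4 < |d_{K′}|`, `L(E_{2p}^{(d_{K′})}, 1) ≠ 0`, `h(K′) < p`, `p ∤ h(K′)` — modulo Burungale–Tian 2026 Thm 1.1 ONLY**
  (cell data `exists_cellData_two_p`, witness field `exists_witnessField_five_of`, support of `N(E_{2p})` by good reduction — all by name);
  the three-facts form `cruxOnE2pCorner_of_three_facts` is this one with two idle binders;
* §3 ★★ `heegnerTwistCouplingInSupply_of_eq_congruentNumberCurve_two_mul_of_BT` — the crux body for every `W = E_{2n}`, `n` prime
  `≡ 3 (mod 4)` (w2 g13's appendix VERBATIM minus `hM`, `hBF`): modulo Burungale–Tian ONLY.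

NET for the corner layer: the crux's conclusion holds modulo ONE named fact (Burungale–Tian) on `W = E_p` (every prime `p ≡ 7 (mod 8)`,
w2 g13), on `W = E_{2p}` (every prime `p ≡ 3 (mod 4)`, `p ≥ 7`, this file) and on the quartic members `y² = x³ + p x`, `+ p³ x`
(`63/64` of `p ≡ 15 (mod 16)`, w3 g12). HONEST FRAMING: typed sub-corners on one CM family; the crux (all CM `W` of analytic rank one;
residual C⁺ on the tail) is NOT closed; BSD is not proved by any of this. THEOREMS ONLY; supports stmt-BirchSwinnertonDyer-21381.
-/

noncomputable section

open scoped Classical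

namespace Summit.BirchSwinnertonDyer.BirchSwinnertonDyer.Theorems.BiquadraticEisensteinDescentHeegnerTwistCouplingInSupplyCornersE2pOneFact

open _root_.WeierstrassCurve Literature.NumberTheory.EllipticCurves Literature.NumberTheory.EllipticCurves.HeathBrown1994
  Literature.NumberTheory.EllipticCurves.Rank1Residual
open Literature.NumberTheory.EllipticCurves.CongruentNumberMonskySelmer
  (card_selmerGroup_two_eq_four_of_det_even' card_selmerGroup_two_eq_four_of_det_odd')
open Summit.BirchSwinnertonDyer.BirchSwinnertonDyer.Theorems.BiquadraticEisensteinDescentHeegnerTwistCouplingInSupplyThreeSquaresPinRankZero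
  (vecTriple_injective two_mul_prod_vecTriple prod_vecTriple)
open Summit.BirchSwinnertonDyer.BirchSwinnertonDyer.Theorems.BiquadraticEisensteinDescentHeegnerTwistCouplingInSupplyIndefinitePinWitness
  (exists_witnessField_five_of)
open Summit.BirchSwinnertonDyer.BirchSwinnertonDyer.Theorems.BiquadraticEisensteinDescentHeegnerTwistCouplingInSupplyCornersThreeFacts
  (exists_cellData_two_p eq_two_or_eq_of_prime_dvd_conductorNorm_two_p)
open Summit.BirchSwinnertonDyer.BirchSwinnertonDyer.Theorems.BiquadraticEisensteinDescentHeegnerTwistCouplingInSupplyRoundingPinCruxOnFamily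
  (eq_of_not_good_congruentNumberCurve_two_mul)

/-! ## §1 The journal doors modulo Burungale–Tian ONLY (Monsky = tree theorem; Burungale–Flach not needed for `L ≠ 0`) -/

/-- Bookkeeping: the three hypotheses on the vector `![a, b, c]` of three distinct odd primes. [folklore] -/
theorem vecTriple_hyps {a b c : ℕ} (ha : a.Prime) (hb : b.Prime) (hc : c.Prime) (ha2 : a % 2 = 1) (hb2 : b % 2 = 1)
    (hc2 : c % 2 = 1) (hab : a ≠ b) (hac : a ≠ c) (hbc : b ≠ c) :
    (∀ i, ((![a, b, c] : Fin 3 → ℕ) i).Prime) ∧ (∀ i, Odd ((![a, b, c] : Fin 3 → ℕ) i)) ∧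
      Function.Injective (![a, b, c] : Fin 3 → ℕ) := by
  refine ⟨fun i => ?_, fun i => ?_, vecTriple_injective hab hac hbc⟩
  · fin_cases i <;> assumption
  · fin_cases i
    · exact Nat.odd_iff.mpr ha2
    · exact Nat.odd_iff.mpr hb2
    · exact Nat.odd_iff.mpr hc2

/-- **Even door, ONE fact**: for distinct odd primes `a, b, c` with Monsky's even determinant `det M(a, b, c) = 1`, the curve
`E_{2abc} : y² = x³ − (2abc)²x` has `#Sel₂ = 4` UNCONDITIONALLY (upper-bound half of Monsky's formula, a tree theorem), hence analytic
rank `0` and `L(E_{2abc}, 1) ≠ 0` modulo Burungale–Tian's rank-zero `2`-converse for CM curves ONLY (`L(E_n, s)` entire is the tree's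
theorem). [cite: HeathBrown1994SelmerCongruentII, Appendix (Monsky), typescript p. 41 L20–L36] [cite: BurungaleTian2026, Thm. 1.1]
[cite: KoblitzECMF1993, Ch. II §5, Theorem (p. 84)] -/
theorem analyticRank_eq_zero_of_det_even_BT {a b c : ℕ}
    (hBT : burungaleTian_analyticRank_eq_zero_of_selmerCorank_eq_zero_of_hasCM)
    (ha : a.Prime) (hb : b.Prime) (hc : c.Prime) (ha2 : a % 2 = 1) (hb2 : b % 2 = 1) (hc2 : c % 2 = 1)
    (hab : a ≠ b) (hac : a ≠ c) (hbc : b ≠ c) (hdet : (monskyMatrixEven ![a, b, c]).det = 1) :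
    Squarefree (2 * a * (b * c)) ∧ Nat.card ((congruentNumberCurve (2 * a * (b * c))).selmerGroup 2) = 4 ∧
      (congruentNumberCurve (2 * a * (b * c))).analyticRank = 0 ∧
      (congruentNumberCurve (2 * a * (b * c))).entireLFunction 1 ≠ 0 := by
  obtain ⟨hprime, hodd, hinj⟩ := vecTriple_hyps ha hb hc ha2 hb2 hc2 hab hac hbc
  have hsq0 := squarefree_two_mul_prod_of_injective (![a, b, c] : Fin 3 → ℕ) hprime hodd hinj
  rw [two_mul_prod_vecTriple] at hsq0
  haveI := isElliptic_congruentNumberCurve hsq0.ne_zero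
  have hsel : Nat.card ((congruentNumberCurve (2 * a * (b * c))).selmerGroup 2) = 4 :=
    card_selmerGroup_two_eq_four_of_det_even' (![a, b, c] : Fin 3 → ℕ) (two_mul_prod_vecTriple a b c) hprime hodd hinj hdet
  exact ⟨hsq0, hsel, L_one_ne_zero_congruentNumberCurve_of_card_selmerGroup_two hBT hsq0 hsel⟩

/-- **Odd door, ONE fact**: for distinct odd primes `a, b, c` with Monsky's odd determinant `det M(a, b, c) = 1`, `E_{abc}` has
`#Sel₂ = 4` UNCONDITIONALLY, hence analytic rank `0` and `L(E_{abc}, 1) ≠ 0` modulo Burungale–Tian ONLY.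
[cite: HeathBrown1994SelmerCongruentII, Appendix (Monsky), typescript p. 39 L27–L33] [cite: BurungaleTian2026, Thm. 1.1]
[cite: KoblitzECMF1993, Ch. II §5, Theorem (p. 84)] -/
theorem analyticRank_eq_zero_of_det_odd_BT {a b c : ℕ}
    (hBT : burungaleTian_analyticRank_eq_zero_of_selmerCorank_eq_zero_of_hasCM)
    (ha : a.Prime) (hb : b.Prime) (hc : c.Prime) (ha2 : a % 2 = 1) (hb2 : b % 2 = 1) (hc2 : c % 2 = 1)
    (hab : a ≠ b) (hac : a ≠ c) (hbc : b ≠ c) (hdet : (monskyMatrixOdd ![a, b, c]).det = 1) :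
    Squarefree (a * (b * c)) ∧ Nat.card ((congruentNumberCurve (a * (b * c))).selmerGroup 2) = 4 ∧
      (congruentNumberCurve (a * (b * c))).analyticRank = 0 ∧
      (congruentNumberCurve (a * (b * c))).entireLFunction 1 ≠ 0 := by
  obtain ⟨hprime, hodd, hinj⟩ := vecTriple_hyps ha hb hc ha2 hb2 hc2 hab hac hbc
  have hsq0 := squarefree_prod_of_injective (![a, b, c] : Fin 3 → ℕ) hprime hinj
  rw [prod_vecTriple] at hsq0
  haveI := isElliptic_congruentNumberCurve hsq0.ne_zero
  have hsel : Nat.card ((congruentNumberCurve (a * (b * c))).selmerGroup 2) = 4 :=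
    card_selmerGroup_two_eq_four_of_det_odd' (![a, b, c] : Fin 3 → ℕ) (prod_vecTriple a b c) hprime hodd hinj hdet
  exact ⟨hsq0, hsel, L_one_ne_zero_congruentNumberCurve_of_card_selmerGroup_two hBT hsq0 hsel⟩

/-- **Even door with the BSD triple, TWO facts** (Monsky fed by the tree theorem `monsky_card_selmerGroup_two_even_holds`): the statement
of `…CornersE2pFourFacts.analyticRank_eq_zero_of_det_even_fourFacts` with the binder `hM` deleted.
[cite: HeathBrown1994SelmerCongruentII, Appendix (Monsky), typescript p. 41 L20–L36] [cite: BurungaleTian2026, Thm. 1.1]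
[cite: BurungaleFlach2024, Thm. 1.1 and Cor. 2] -/
theorem bsdTriple_of_det_even_BT_BF {a b c : ℕ}
    (hBT : burungaleTian_analyticRank_eq_zero_of_selmerCorank_eq_zero_of_hasCM) (hBF : bsdTriple_of_hasCM_of_L_one_ne_zero)
    (ha : a.Prime) (hb : b.Prime) (hc : c.Prime) (ha2 : a % 2 = 1) (hb2 : b % 2 = 1) (hc2 : c % 2 = 1)
    (hab : a ≠ b) (hac : a ≠ c) (hbc : b ≠ c) (hdet : (monskyMatrixEven ![a, b, c]).det = 1) :
    Squarefree (2 * a * (b * c)) ∧ (congruentNumberCurve (2 * a * (b * c))).BSDTriple ∧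
      (congruentNumberCurve (2 * a * (b * c))).analyticRank = 0 ∧
      (congruentNumberCurve (2 * a * (b * c))).entireLFunction 1 ≠ 0 :=
  BiquadraticEisensteinDescentHeegnerTwistCouplingInSupplyCornersE2pFourFacts.analyticRank_eq_zero_of_det_even_fourFacts
    monsky_card_selmerGroup_two_even_holds hBT hBF ha hb hc ha2 hb2 hc2 hab hac hbc hdet

/-- **Odd door with the BSD triple, TWO facts** (Monsky fed by the tree theorem `monsky_card_selmerGroup_two_odd_holds`).
[cite: HeathBrown1994SelmerCongruentII, Appendix (Monsky), typescript p. 39 L27–L33] [cite: BurungaleTian2026, Thm. 1.1]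
[cite: BurungaleFlach2024, Thm. 1.1 and Cor. 2] -/
theorem bsdTriple_of_det_odd_BT_BF {a b c : ℕ}
    (hBT : burungaleTian_analyticRank_eq_zero_of_selmerCorank_eq_zero_of_hasCM) (hBF : bsdTriple_of_hasCM_of_L_one_ne_zero)
    (ha : a.Prime) (hb : b.Prime) (hc : c.Prime) (ha2 : a % 2 = 1) (hb2 : b % 2 = 1) (hc2 : c % 2 = 1)
    (hab : a ≠ b) (hac : a ≠ c) (hbc : b ≠ c) (hdet : (monskyMatrixOdd ![a, b, c]).det = 1) :
    Squarefree (a * (b * c)) ∧ (congruentNumberCurve (a * (b * c))).BSDTriple ∧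
      (congruentNumberCurve (a * (b * c))).analyticRank = 0 ∧
      (congruentNumberCurve (a * (b * c))).entireLFunction 1 ≠ 0 :=
  BiquadraticEisensteinDescentHeegnerTwistCouplingInSupplyCornersE2pFourFacts.analyticRank_eq_zero_of_det_odd_fourFacts
    monsky_card_selmerGroup_two_odd_holds hBT hBF ha hb hc ha2 hb2 hc2 hab hac hbc hdet

/-! ## §2 ★★ The corner `W = E_{2p}`, every prime `p ≡ 3 (mod 4)`, `p ≥ 7` — Burungale–Tian ONLY -/

/-- ★★ **THE CONGRUENT CORNER `W = E_{2p}`, ONE NAMED FACT: every prime `p ≡ 3 (mod 4)`, `p ≥ 7`** — modulo Burungale–Tian's rank-zero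
`2`-converse for CM curves ONLY there is a Heegner field `K′` of `N(E_{2p})` with `4 < |d_{K′}|`, `L(E_{2p}^{(d_{K′})}, 1) ≠ 0`,
`h(K′) < p` and `p ∤ h(K′)` (the statement of `…CornersThreeFacts.cruxOnE2pCorner_of_three_facts` with `hM`, `hBF` deleted: cell data
`exists_cellData_two_p` — a prime `q ≡ 3 (mod 8)`, `q ≠ p`, `det M(p, q, 5) = 1`, `(−5q/p) = +1`, `h(ℚ(√−5q)) < p` —, `#Sel₂(E_{10pq}) = 4`
unconditionally, the Burungale–Tian door, and the witness field `K′ = ℚ(√−5q)`, Heegner for `N(E_{2p})` whose support is `{2, p}` by good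
reduction). [cite: HeathBrown1994SelmerCongruentII, Appendix (Monsky), typescript p. 41 L20–L36] [cite: BurungaleTian2026, Thm. 1.1]
[cite: KoblitzECMF1993, Ch. II §5, Theorem (p. 84)] [cite: Marcus2018, Ch. 3 Thm. 25] -/
theorem cruxOnE2pCorner_of_BT (hBT : burungaleTian_analyticRank_eq_zero_of_selmerCorank_eq_zero_of_hasCM) :
    ∀ (p : ℕ) [Fact p.Prime] [(congruentNumberCurve (2 * p)).IsElliptic]
      [(congruentNumberCurve (2 * p)).IsGloballyMinimal]
      [NeZero ((congruentNumberCurve (2 * p)).conductorNorm ℤ)],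
      p % 4 = 3 → 7 ≤ p →
      ∃ (K : Type) (_ : Field K) (_ : NumberField K),
        IsImaginaryQuadratic K ∧ 4 < (NumberField.discr K).natAbs ∧
        SatisfiesHeegnerHypothesis ((congruentNumberCurve (2 * p)).conductorNorm ℤ) K ∧
        ((congruentNumberCurve (2 * p)).quadraticTwist (NumberField.discr K : ℚ)).entireLFunction 1 ≠ 0 ∧
        NumberField.classNumber K < p ∧ ¬ p ∣ NumberField.classNumber K := by
  intro p hpF _ _ _ hp4 h7
  have hp : p.Prime := hpF.out
  obtain ⟨q, hq, hq8, hqp, hdet, hJ5, hh⟩ := exists_cellData_two_p hp hp4 h7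
  obtain ⟨-, -, -, hL⟩ := analyticRank_eq_zero_of_det_even_BT hBT hp hq Nat.prime_five (by omega) (by omega)
    (by norm_num) (Ne.symm hqp) (by rintro rfl; omega) (by rintro rfl; omega) hdet
  obtain ⟨K, iF, iN, hK, hdK, hH', hcl⟩ := exists_witnessField_five_of (N := (congruentNumberCurve (2 * p)).conductorNorm ℤ)
    hq hq8 hJ5 hh (fun r hr hrN => eq_two_or_eq_of_prime_dvd_conductorNorm_two_p hp hr hrN)
  refine ⟨K, iF, iN, hK, ?_, hH', ?_, hcl, fun hdvd =>
    absurd (Nat.le_of_dvd (NumberField.classNumber_pos K) hdvd) (not_le.mpr hcl)⟩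
  · rw [hdK, Int.natAbs_neg, Int.natAbs_natCast]
    have := hq.two_le
    omega
  · rw [hdK, quadraticTwist_congruentNumberCurve, Int.natAbs_neg, Int.natAbs_natCast]
    have h55 : 2 * p * (5 * q) = 2 * p * (q * 5) := by ring
    rw [h55]
    exact hL

/-! ## §3 ★★ The crux body on the family `{E_{2n} : n prime, n ≡ 3 (mod 4)}` — Burungale–Tian ONLY -/

/-- ★★ **THE CRUX BODY FOR EVERY `W` IN THE FAMILY `{E_{2n} : n prime, n ≡ 3 (mod 4)}`, ONE NAMED FACT** — the body of
`HeegnerTwistCouplingInSupply` with the single extra hypothesis `∃ n, n.Prime ∧ n % 4 = 3 ∧ W = E_{2n}` (the statement of w2 g13's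
`…RoundingPinCruxOnFamily.heegnerTwistCouplingInSupply_of_eq_congruentNumberCurve_two_mul` with `hM`, `hBF` deleted), modulo
Burungale–Tian 2026 Thm 1.1 ONLY: `¬ Good ∧ 5 ≤ p` force `p = n ≥ 7`, then `cruxOnE2pCorner_of_BT`. The ∀B supply hypothesis and
`HasCM` / `r_an = 1` / `CMInert` are idle. [cite: BurungaleTian2026, Thm. 1.1] [cite: SilvermanAEC2009, VII.5 Prop. 5.1(a)] -/
theorem heegnerTwistCouplingInSupply_of_eq_congruentNumberCurve_two_mul_of_BT
    (hBT : burungaleTian_analyticRank_eq_zero_of_selmerCorank_eq_zero_of_hasCM) :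
    ∀ (W : WeierstrassCurve ℚ) [W.IsElliptic] [W.IsGloballyMinimal] (p : ℕ) [Fact p.Prime] [NeZero (W.conductorNorm ℤ)],
      (∃ n : ℕ, n.Prime ∧ n % 4 = 3 ∧ W = congruentNumberCurve (2 * n)) →
      W.HasCM → W.analyticRank = 1 → 5 ≤ p → CMInert W p → ¬ Good W p →
      (∀ B : ℕ, ∃ (K : Type) (_ : Field K) (_ : NumberField K), IsImaginaryQuadratic K ∧ B < (NumberField.discr K).natAbs ∧
        4 < (NumberField.discr K).natAbs ∧ SatisfiesHeegnerHypothesis (W.conductorNorm ℤ) K ∧ ¬ p ∣ NumberField.classNumber K) →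
      ∃ (K : Type) (_ : Field K) (_ : NumberField K),
        IsImaginaryQuadratic K ∧ 4 < (NumberField.discr K).natAbs ∧
        SatisfiesHeegnerHypothesis (W.conductorNorm ℤ) K ∧
        (W.quadraticTwist (NumberField.discr K : ℚ)).entireLFunction 1 ≠ 0 ∧ ¬ p ∣ NumberField.classNumber K := by
  intro W _ _ p _ _ hW _ _ h5 _ hbad _
  obtain ⟨n, hn, hn4, rfl⟩ := hW
  obtain rfl := eq_of_not_good_congruentNumberCurve_two_mul hn h5 hbad
  obtain ⟨K, iF, iN, hK, h4, hH, hL, -, hndvd⟩ := cruxOnE2pCorner_of_BT hBT p hn4 (by omega)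
  exact ⟨K, iF, iN, hK, h4, hH, hL, hndvd⟩

end Summit.BirchSwinnertonDyer.BirchSwinnertonDyer.Theorems.BiquadraticEisensteinDescentHeegnerTwistCouplingInSupplyCornersE2pOneFact

end
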